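import Summits.CriticalPhenomena.PercolationContinuityZ3.Theorems.PercNearOneGluingNoHeavyLowerTailMajorityGluingZFourteenEightP13
import Summits.CriticalPhenomena.PercolationContinuityZ3.Theorems.PercNearOneGluingNoHeavyLowerTailMajorityGluingZFourteenEightP14
import Summits.CriticalPhenomena.PercolationContinuityZ3.Theorems.PercNearOneGluingNoHeavyLowerTailMajorityGluingZFourteenEightP15
import Summits.CriticalPhenomena.PercolationContinuityZ3.Theorems.PercNearOneGluingNoHeavyLowerTailMajorityGluingZFourteenEightP16
import Summits.CriticalPhenomena.PercolationContinuityZ3.Theorems.PercNearOneGluingNoHeavyLowerTailMajorityGluingZFourteenEightP17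
import Summits.CriticalPhenomena.PercolationContinuityZ3.Theorems.PercNearOneGluingNoHeavyLowerTailMajorityGluingZFourteenEightP18
import Summits.CriticalPhenomena.PercolationContinuityZ3.Theorems.PercNearOneGluingNoHeavyLowerTailMajorityGluingZFourteenEightP19
import Summits.CriticalPhenomena.PercolationContinuityZ3.Theorems.PercNearOneGluingNoHeavyLowerTailMajorityGluingZFourteenEightP20
import Summits.CriticalPhenomena.PercolationContinuityZ3.Theorems.PercNearOneGluingNoHeavyLowerTailMajorityGluingZFourteenEightP21
import Summits.CriticalPhenomena.PercolationContinuityZ3.Theorems.PercNearOneGluingNoHeavyLowerTailMajorityGluingZFourteenEightP22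
import Summits.CriticalPhenomena.PercolationContinuityZ3.Theorems.PercNearOneGluingNoHeavyLowerTailMajorityGluingZFourteenEightP23
import Summits.CriticalPhenomena.PercolationContinuityZ3.Theorems.PercNearOneGluingNoHeavyLowerTailMajorityGluingZFourteenEightP24
import Summits.CriticalPhenomena.PercolationContinuityZ3.Theorems.PercNearOneGluingNoHeavyLowerTailMajorityGluingZFourteenEightHG2C1
import Summits.CriticalPhenomena.PercolationContinuityZ3.Theorems.PercNearOneGluingNoHeavyLowerTailMajorityGluingZFourteenEightHG2C2
import Summits.CriticalPhenomena.PercolationContinuityZ3.Theorems.PercNearOneGluingNoHeavyLowerTailMajorityGluingZFourteenEightHG2C3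
import Summits.CriticalPhenomena.PercolationContinuityZ3.Theorems.PercNearOneGluingNoHeavyLowerTailMajorityGluingZFourteenEightHG2C4
import Summits.CriticalPhenomena.PercolationContinuityZ3.Theorems.PercNearOneGluingNoHeavyLowerTailMajorityGluingZFourteenEightHG2C5
import Summits.CriticalPhenomena.PercolationContinuityZ3.Theorems.PercNearOneGluingNoHeavyLowerTailMajorityGluingZFourteenEightHG2C6
import Summits.CriticalPhenomena.PercolationContinuityZ3.Theorems.PercNearOneGluingNoHeavyLowerTailMajorityGluingZRangeAM
import HarnessLib

/-!
# Group 2 of 7 of the `(14,8)` certificate at `c = 3/2`: its aggregate-merge tree IS the concatenation of its 6 key-range chunks (lane prim-rate, constants-miner 1, gen 39; cert/mkhier.py)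

Support file for the closed crux `NoHeavyLowerTail` (stmt-CriticalPhenomena-4575), majority-gluing line.  The 12 parts P13, P14, P15, P16, P17, P18, P19, P20, P21, P22, P23, P24 (kit j310356) carry verified
type-space digests `…D`; `fourteenEightT2G2T` is their binary tree of aggregated merges (`am`, …MajorityGluingZRangeAM, depth 4); the kernel verifies `fourteenEightT2G2T = [chunks].flatten`
(`fourteenEightT2G2_eq`), and `fourteenEightT2G2_val` identifies the value of the group's digests with the value of its chunks (`evalC_am`).  No sorries. [cite: VandenbergKahn2001, Thm 1.2 (p. 123)]
-/

namespace Summit.CriticalPhenomena.PercolationContinuityZ3.Theorems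

namespace HubOnly
namespace QCert

/-- The aggregate-merge tree of group 2. -/
def fourteenEightT2G2T : List (ℕ × ℤ) :=
  am (am (am (am (fourteenEightTP13D) (fourteenEightTP14D)) (am (fourteenEightTP15D) (fourteenEightTP16D))) (am (am (fourteenEightTP17D) (fourteenEightTP18D)) (am (fourteenEightTP19D) (fourteenEightTP20D)))) (am (am (fourteenEightTP21D) (fourteenEightTP22D)) (am (fourteenEightTP23D) (fourteenEightTP24D)))

set_option maxRecDepth 8192 in
set_option maxHeartbeats 0 in
/-- **The tree of group 2 equals the concatenation of its key-range chunks** (kernel evaluation). -/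
theorem fourteenEightT2G2_eq : fourteenEightT2G2T = [fourteenEightT2G2C1, fourteenEightT2G2C2, fourteenEightT2G2C3, fourteenEightT2G2C4, fourteenEightT2G2C5, fourteenEightT2G2C6].flatten := by
  decide +kernel

/-- The tree's value is the value of the group's digests. -/
theorem fourteenEightT2G2_treeVal (val : ℕ → ℝ) : evalC val fourteenEightT2G2T = evalC val [fourteenEightTP13D, fourteenEightTP14D, fourteenEightTP15D, fourteenEightTP16D, fourteenEightTP17D, fourteenEightTP18D, fourteenEightTP19D, fourteenEightTP20D, fourteenEightTP21D, fourteenEightTP22D, fourteenEightTP23D, fourteenEightTP24D].flatten := by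
  simp only [fourteenEightT2G2T, evalC_am, List.flatten_cons, List.flatten_nil, evalC_append, evalC_nil', add_assoc, add_zero]

/-- **The value of group 2's digests is the value of its chunks.** -/
theorem fourteenEightT2G2_val (val : ℕ → ℝ) : evalC val [fourteenEightTP13D, fourteenEightTP14D, fourteenEightTP15D, fourteenEightTP16D, fourteenEightTP17D, fourteenEightTP18D, fourteenEightTP19D, fourteenEightTP20D, fourteenEightTP21D, fourteenEightTP22D, fourteenEightTP23D, fourteenEightTP24D].flatten = evalC val [fourteenEightT2G2C1, fourteenEightT2G2C2, fourteenEightT2G2C3, fourteenEightT2G2C4, fourteenEightT2G2C5, fourteenEightT2G2C6].flatten := by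
  rw [← fourteenEightT2G2_treeVal val, fourteenEightT2G2_eq]

end QCert
end HubOnly

end Summit.CriticalPhenomena.PercolationContinuityZ3.Theorems
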